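import Summits.KontsevichZagierPeriods.KontsevichZagierPeriods.Theorems.LiouvilleUnfoldingLogKernelConjectureIffSummit
import Summits.KontsevichZagierPeriods.KontsevichZagierPeriods.Theorems.VietaFibreKernelFormItemDictionary

/-!
# `LogKernelConjecture` (stmt-KontsevichZagierPeriods-2837) split along `[π]` into the EXISTING items
# stmt-KontsevichZagierPeriods-0541 (`AyoubPiLocalKernel`) and stmt-KontsevichZagierPeriods-0540 (`AyoubPiCancellation`)

Strategist's decomposition of the last open node of route LiouvilleUnfolding (crux-strategist,
wall-breaker generation 1, planner-cstrat-stmt-KontsevichZagierPeriods-2837-p1-0, 2026-08-17).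

The crux `LiouvilleUnfolding.LogKernelConjecture` (the period conjecture for the five-rule calculus)
IS the summit (`SpectatorLocalisation.logKernelConjecture_iff_summit`, p95927, because the logarithmic
Newton–Leibniz rule is a derived move, `LogPrimitiveNL_of`). The only exact two-piece split of the
summit with both pieces already FILED, VETTED and STAFFED items is route AyoubSpecialisation's
`π`-localisation: `AyoubPiLocalKernel` (item 0541: every formal combination of value `0` becomes a
relation after enough multiplications by a pinned product `P n r = [π] ⋆ r`) and `AyoubPiCancellation`
(item 0540: `P`-multiplication reflects relations — transcendence-free, the effective-versus-localised
seam). This file proves the glue BY THE LITERAL STATEMENTS of the two items (so that the children of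
the split are those items, attached by normalised signature, and not new ones):

* `LogKernelConjecture_of_subs : ⟨body of 0541⟩ → ⟨body of 0540⟩ → LogKernelConjecture` — the glue;
* `LogKernelConjecture_iff_subs` — the split is EXACT (`↔`), so neither child is banked for free and
  the two children are jointly the crux (hence the summit).

Nothing is re-proved: the pairing `KernelForm ↔ AyoubPiLocalKernel ∧ AyoubPiCancellation` is the tree
theorem `KernelForm.LocaliseAtValuePrime.kernelForm_iff_ayoubPiLocalKernel_and_ayoubPiCancellation`
(`VietaFibre.KernelForm` is `KZKernelConjecture` on the nose), composed with
`logKernelConjecture_iff_kzKernelConjecture`. Sources: M. Kontsevich, D. Zagier, *Periods* (2001),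
§1.2 Conjecture 1 and §4.1 (`P̂ = P[(2πi)⁻¹]`); J. Ayoub, *Periods and the conjectures of
Grothendieck and Kontsevich–Zagier*, EMS Newsl. 91 (2014), Def. 6 / Conj. 7; A. Huber, G. Wüstholz,
*Transcendence and linear relations of 1-periods* (2022), App. A.3–A.4.
-/

noncomputable section

open Literature.NumberTheory.Transcendental

namespace Summit.KontsevichZagierPeriods.LiouvilleUnfolding.LogKernelConjectureSplit

open Summit.KontsevichZagierPeriods.KontsevichZagierPeriods.Theses

/-- The two filed items, by name, decide the crux and conversely (exactness of the split):
`LogKernelConjecture ↔ AyoubPiLocalKernel ∧ AyoubPiCancellation` (stmt-2837 ↔ stmt-0541 ∧ stmt-0540).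
[Kontsevich–Zagier 2001, §1.2 Conj. 1, §4.1; Ayoub 2014, Def. 6 / Conj. 7] [folklore] -/
theorem logKernelConjecture_iff_ayoubPiLocalKernel_and_ayoubPiCancellation :
    LiouvilleUnfolding.LogKernelConjecture ↔
      AyoubSpecialisation.AyoubPiLocalKernel ∧ AyoubSpecialisation.AyoubPiCancellation :=
  Summit.KontsevichZagierPeriods.LiouvilleUnfolding.SpectatorLocalisation.logKernelConjecture_iff_kzKernelConjecture.trans
    (show KZKernelConjecture ↔ _ from
      Summit.KontsevichZagierPeriods.KernelForm.LocaliseAtValuePrime.kernelForm_iff_ayoubPiLocalKernel_and_ayoubPiCancellation)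

/-- **The glue of the split, by the literal statements of the children** (items 0541, 0540 as filed
in route AyoubSpecialisation; `Sub₁ → Sub₂ → Crux`). [folklore] -/
theorem LogKernelConjecture_of_subs
    (h₁ : ∀ (P : ∀ n : ℕ, Literature.NumberTheory.Transcendental.KZ.IntegralRep n → Literature.NumberTheory.Transcendental.KZ.IntegralRep (n + 2)), (∀ (n : ℕ) (r : Literature.NumberTheory.Transcendental.KZ.IntegralRep n), (P n r).domain = {z : Fin (n + 2) → ℝ | z 0 ^ 2 + z 1 ^ 2 ≤ 1 ∧ (fun i : Fin n => z i.succ.succ) ∈ r.domain} ∧ (P n r).integrand = fun z => r.integrand (fun i : Fin n => z i.succ.succ)) → ∀ c : Literature.NumberTheory.Transcendental.KZ.FormalRep, Literature.NumberTheory.Transcendental.KZ.eval c = 0 → ∃ N : ℕ, (⇑(FreeAbelianGroup.lift (fun s : (Σ n, Literature.NumberTheory.Transcendental.KZ.IntegralRep n) => Literature.NumberTheory.Transcendental.KZ.of (P s.1 s.2))))^[N] c ∈ Literature.NumberTheory.Transcendental.KZ.relations)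
    (h₂ : ∀ (P : ∀ n : ℕ, Literature.NumberTheory.Transcendental.KZ.IntegralRep n → Literature.NumberTheory.Transcendental.KZ.IntegralRep (n + 2)), (∀ (n : ℕ) (r : Literature.NumberTheory.Transcendental.KZ.IntegralRep n), (P n r).domain = {z : Fin (n + 2) → ℝ | z 0 ^ 2 + z 1 ^ 2 ≤ 1 ∧ (fun i : Fin n => z i.succ.succ) ∈ r.domain} ∧ (P n r).integrand = fun z => r.integrand (fun i : Fin n => z i.succ.succ)) → ∀ c : Literature.NumberTheory.Transcendental.KZ.FormalRep, FreeAbelianGroup.lift (fun s : (Σ n, Literature.NumberTheory.Transcendental.KZ.IntegralRep n) => Literature.NumberTheory.Transcendental.KZ.of (P s.1 s.2)) c ∈ Literature.NumberTheory.Transcendental.KZ.relations → c ∈ Literature.NumberTheory.Transcendental.KZ.relations) :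
    Summit.KontsevichZagierPeriods.KontsevichZagierPeriods.Theses.LiouvilleUnfolding.LogKernelConjecture :=
  logKernelConjecture_iff_ayoubPiLocalKernel_and_ayoubPiCancellation.2 ⟨h₁, h₂⟩

/-- **Exactness**, by the literal statements: the crux implies both children (so the split loses
nothing and neither child is the crux weakened for free). [folklore] -/
theorem LogKernelConjecture_iff_subs :
    Summit.KontsevichZagierPeriods.KontsevichZagierPeriods.Theses.LiouvilleUnfolding.LogKernelConjecture ↔
    ((∀ (P : ∀ n : ℕ, Literature.NumberTheory.Transcendental.KZ.IntegralRep n → Literature.NumberTheory.Transcendental.KZ.IntegralRep (n + 2)), (∀ (n : ℕ) (r : Literature.NumberTheory.Transcendental.KZ.IntegralRep n), (P n r).domain = {z : Fin (n + 2) → ℝ | z 0 ^ 2 + z 1 ^ 2 ≤ 1 ∧ (fun i : Fin n => z i.succ.succ) ∈ r.domain} ∧ (P n r).integrand = fun z => r.integrand (fun i : Fin n => z i.succ.succ)) → ∀ c : Literature.NumberTheory.Transcendental.KZ.FormalRep, Literature.NumberTheory.Transcendental.KZ.eval c = 0 → ∃ N : ℕ, (⇑(FreeAbelianGroup.lift (fun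 s : (Σ n, Literature.NumberTheory.Transcendental.KZ.IntegralRep n) => Literature.NumberTheory.Transcendental.KZ.of (P s.1 s.2))))^[N] c ∈ Literature.NumberTheory.Transcendental.KZ.relations) ∧
     (∀ (P : ∀ n : ℕ, Literature.NumberTheory.Transcendental.KZ.IntegralRep n → Literature.NumberTheory.Transcendental.KZ.IntegralRep (n + 2)), (∀ (n : ℕ) (r : Literature.NumberTheory.Transcendental.KZ.IntegralRep n), (P n r).domain = {z : Fin (n + 2) → ℝ | z 0 ^ 2 + z 1 ^ 2 ≤ 1 ∧ (fun i : Fin n => z i.succ.succ) ∈ r.domain} ∧ (P n r).integrand = fun z => r.integrand (fun i : Fin n => z i.succ.succ)) → ∀ c : Literature.NumberTheory.Transcendental.KZ.FormalRep, FreeAbelianGroup.lift (fun s : (Σ n, Literature.NumberTheory.Transcendental.KZ.IntegralRep n) => Literature.NumberTheory.Transcendental.KZ.of (P s.1 s.2)) c ∈ Literature.NumberTheory.Transcendental.KZ.relations → c ∈ Literature.NumberTheory.Transcendental.KZ.relations)) :=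
  logKernelConjecture_iff_ayoubPiLocalKernel_and_ayoubPiCancellation

/-- Position of the children against the summit (for the record; both are tree theorems already):
the crux, hence `KontsevichZagierPeriods`, follows from the two children and implies each. -/
theorem summit_iff_subs :
    KontsevichZagierPeriods ↔
      AyoubSpecialisation.AyoubPiLocalKernel ∧ AyoubSpecialisation.AyoubPiCancellation :=
  Summit.KontsevichZagierPeriods.LiouvilleUnfolding.SpectatorLocalisation.logKernelConjecture_iff_summit.symm.trans
    logKernelConjecture_iff_ayoubPiLocalKernel_and_ayoubPiCancellation

end Summit.KontsevichZagierPeriods.LiouvilleUnfolding.LogKernelConjectureSplit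

end
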